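import Summits.Parity.GeneralizedHardyLittlewood.Theorems.LeeYangFibresRelativeDimOneGRHCalibration
import Literature.NumberTheory.LFunctions.SiegelWalfisz
import Literature.NumberTheory.LFunctions.PageUniformPNTConductor
import HarnessLib

/-!
# Route `LeeYangFibres`, crux `RelativeDimOne` (stmt-Parity-14113), line `gallagher-backwards-split` (seat c3):
# the `L`-atom HOLDS UNCONDITIONALLY at Siegel–Walfisz level

The line reduced the crux to `IncidenceBandlimitedCoreDecay θ ∧ LowClassSecondMoment θ₁` for every power level
`0 < θ₁ ≤ 1` (`relativeDimOne_iff_general`, `Theorems/LeeYangFibresRelativeDimOneTypeSplit.lean`); the `L`-atom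
`LowClassSecondMoment θ₁` (`Σ_{a mod q} ψ(N;q,a)² ≤ (1+ε)(N²/φ(q) + N log N)` for all `q ≤ N^{θ₁}`) is open at every
`θ₁ > 0` and follows from GRH (`lowClassSecondMoment_of_grh`, seat c2). This file kernel-checks the OTHER end of the
calibration: at LOGARITHMIC level `q ≤ (log N)^A` (any fixed `A`) the same second-moment bound is a THEOREM, by the
Siegel–Walfisz theorem PROVED in the tree (`Literature.NumberTheory.LFunctions.siegel_walfisz_holds`):

* `lowClassSecondMoment_logLevel` — for every `A : ℕ` and `ε > 0`, eventually in `N`, for all `1 ≤ q ≤ (log N)^A`,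
  `Σ_{a < q} ψ(N;q,a)² ≤ (1+ε)(N²/φ(q) + N log N)`.
* `lowClassSecondMoment_pageLevel` — for `0 < b < 1/4`, `A > 0`, `ε > 0`, eventually in `N`, there is `d` (`d = 0` or
  `d ≥ (log N)^A`) such that the same bound holds for all `1 ≤ q` with `log q ≤ (log N)^b` and `d ∤ q`: beyond every
  power of `log N`, off the multiples of ONE exceptional conductor, by the tree's PROVED Page theorem in conductor form
  (`Literature.NumberTheory.LFunctions.PageUniformPNT.chebyshevPsiMod_uniform_conductor`).

So the unconditional status of the `L`-atom is: a theorem for ALL moduli up to the Siegel–Walfisz level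
`(log N)^{O(1)}`, a theorem for all moduli NOT divisible by one exceptional conductor `d = d(N) ≥ (log N)^A` up to
level `exp((log N)^{1/4-})`, and open exactly at the multiples of `d` (Siegel's theorem with an explicit rate would be
needed); the line's composition needs the power level `N^{θ₁}` for every modulus (seat c3,
`Cruxes/RelativeDimOne/Lines/gallagher-backwards-split.dead.md`).

## Proof

Split the classes `a mod q` into coprime and non-coprime ones. For `(a, q) = 1`, `ψ(N;q,a)` is the tree's
`chebyshevPsiMod q a N` (`classPsi_eq_chebyshevPsiMod`), so Siegel–Walfisz with exponent `A + 1` gives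
`0 ≤ ψ(N;q,a) ≤ N/φ(q) + C N/(log N)^{A+1} ≤ (N/φ(q))(1 + C/log N)` because `φ(q) ≤ q ≤ (log N)^A`; summing the squares
over the `φ(q)` coprime classes gives `≤ (N²/φ(q))(1 + C/log N)² ≤ (1 + ε/2) N²/φ(q)` eventually. The non-coprime classes
carry only powers of primes dividing `q`: `Σ_{(a,q)>1} ψ(N;q,a)² ≤ 9 N log² N` (seat c2's
`GRHCalibration.sum_not_coprime_sq_le`), and `9 N log² N ≤ (ε/2) N²/φ(q)` since `φ(q) log² N ≤ (log N)^{A+2} = o(N)`.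

References: Walfisz 1936 [Walfisz1936]; Montgomery–Vaughan, *Multiplicative Number Theory I*, Cor. 11.19
[MontgomeryVaughan2007]; Davenport, *Multiplicative Number Theory*, ch. 22 [DavenportMNT1980].
-/

noncomputable section

open scoped BigOperators ArithmeticFunction.vonMangoldt
open Finset Filter Asymptotics
open Literature.NumberTheory.Sieve (siegel_walfisz)
open Literature.NumberTheory.Sieve.ParityWave0 (chebyshevPsiMod)
open Summit.Parity.GeneralizedHardyLittlewood.Cruxes.RelativeDimOne.GallagherBackwards

namespace Summit.Parity.GeneralizedHardyLittlewood.Cruxes.RelativeDimOne.TypeSplit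

namespace SWCalibration

/-! ### Dictionary: the line's `classPsi` is the tree's `chebyshevPsiMod` -/

/-- For `a < q`, `ψ(N; q, a)` in the line's normalisation (`classPsi`: `1 ≤ n ≤ N`, `n % q = a`) is the tree's
`chebyshevPsiMod q a N` (`n ≤ N`, `n ≡ a (q)`; the term `n = 0` vanishes as `Λ 0 = 0`). -/
theorem classPsi_eq_chebyshevPsiMod (N : ℕ) {q a : ℕ} (ha : a < q) :
    classPsi N q a = chebyshevPsiMod q (a : ZMod q) N := by
  unfold classPsi chebyshevPsiMod
  rw [Nat.floor_natCast, Nat.range_succ_eq_Icc_zero, ← Finset.insert_Icc_add_one_left_eq_Icc (Nat.zero_le N),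
    sum_insert (by simp), sum_filter, zero_add]
  have h0 : ArithmeticFunction.vonMangoldt.residueClass (a : ZMod q) 0 = 0 := by
    simp [ArithmeticFunction.vonMangoldt.residueClass, Set.indicator_apply]
  rw [h0, zero_add]
  refine sum_congr rfl fun n _ => ?_
  simp only [ArithmeticFunction.vonMangoldt.residueClass, Set.indicator_apply, Set.mem_setOf_eq,
    ZMod.natCast_eq_natCast_iff', Nat.mod_eq_of_lt ha]

/-- Siegel–Walfisz for the line's `classPsi`, coprime classes: `|ψ(N;q,a) − N/φ(q)| ≤ C N/(log N)^B` for
`N ≥ 2`, `1 ≤ q ≤ (log N)^B`, `a < q`, `(a, q) = 1`. -/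
theorem classPsi_sub_le_of_sw {B C : ℝ}
    (hC : ∀ x : ℝ, 2 ≤ x → ∀ q : ℕ, 1 ≤ q → (q : ℝ) ≤ Real.log x ^ B →
      ∀ u : (ZMod q)ˣ, |chebyshevPsiMod q (u : ZMod q) x - x / Nat.totient q| ≤ C * x / Real.log x ^ B)
    {N q a : ℕ} (hN : 2 ≤ N) (hq : 1 ≤ q) (hqB : (q : ℝ) ≤ Real.log N ^ B) (ha : a < q)
    (hcop : a.Coprime q) :
    |classPsi N q a - N / Nat.totient q| ≤ C * N / Real.log N ^ B := by
  haveI : NeZero q := ⟨by omega⟩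
  have h := hC N (by exact_mod_cast hN) q hq hqB (ZMod.unitOfCoprime a hcop)
  rwa [ZMod.coe_unitOfCoprime, ← classPsi_eq_chebyshevPsiMod N ha] at h

/-- The coprime classes: if `0 ≤ ψ(N;q,a) ≤ M` for every coprime `a < q`, then
`Σ_{(a,q)=1} ψ(N;q,a)² ≤ φ(q) M²`. -/
theorem sum_coprime_sq_le {N q : ℕ} {M : ℝ}
    (hM : ∀ a ∈ (range q).filter (fun a => a.Coprime q), classPsi N q a ≤ M) :
    ∑ a ∈ (range q).filter (fun a => a.Coprime q), classPsi N q a ^ 2 ≤ (Nat.totient q : ℝ) * M ^ 2 := by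
  have hcard : ((range q).filter (fun a => a.Coprime q)).card = Nat.totient q := by
    rw [Nat.totient_eq_card_coprime]
    congr 1
    exact filter_congr fun a _ => by rw [Nat.coprime_comm]
  calc ∑ a ∈ (range q).filter (fun a => a.Coprime q), classPsi N q a ^ 2
      ≤ ∑ a ∈ (range q).filter (fun a => a.Coprime q), M ^ 2 :=
        sum_le_sum fun a ha => pow_le_pow_left₀ (classPsi_nonneg N q a) (hM a ha) 2
    _ = (Nat.totient q : ℝ) * M ^ 2 := by rw [sum_const, nsmul_eq_mul, hcard]

/-- `(log N)^r ≤ c N` eventually (natural exponent). -/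
theorem eventually_log_pow_le (r : ℕ) {c : ℝ} (hc : 0 < c) :
    ∀ᶠ N : ℕ in atTop, Real.log N ^ r ≤ c * N := by
  filter_upwards [GRHCalibration.eventually_rpow_mul_log_pow_le (θ₁ := 0) zero_lt_one r zero_le_one hc]
    with N hN
  simpa [Real.rpow_zero] using hN

end SWCalibration

open SWCalibration

/-- **The `L`-atom at Siegel–Walfisz level, UNCONDITIONALLY** (seat c3; registered hook
`lowClassSecondMoment_logLevel` on stmt-Parity-14113): for every `A : ℕ` and `ε > 0` there is `N₀` such that for all
`N ≥ N₀` and all moduli `1 ≤ q ≤ (log N)^A`,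
`Σ_{a < q} ψ(N; q, a)² ≤ (1 + ε) (N²/φ(q) + N log N)` —
the conclusion of `LowClassSecondMoment`, with the power level `N^{θ₁}` replaced by the logarithmic level `(log N)^A`.
From the tree's PROVED Siegel–Walfisz theorem (`Literature.NumberTheory.LFunctions.siegel_walfisz_holds`) with
exponent `A + 1` on the coprime classes and seat c2's bound `9 N log² N` on the non-coprime ones.
[cite: Walfisz1936] [cite: MontgomeryVaughan2007, Corollary 11.19] -/
theorem lowClassSecondMoment_logLevel :
    ∀ (A : ℕ) (ε : ℝ), 0 < ε → ∃ N₀ : ℕ, ∀ N : ℕ, N₀ ≤ N → ∀ q : ℕ, 1 ≤ q → (q : ℝ) ≤ Real.log N ^ A →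
      ∑ a ∈ Finset.range q,
          Summit.Parity.GeneralizedHardyLittlewood.Cruxes.RelativeDimOne.GallagherBackwards.classPsi N q a ^ 2 ≤
        (1 + ε) * ((N : ℝ) ^ 2 / Nat.totient q + N * Real.log N) := by
  intro A ε hε
  -- Siegel–Walfisz with exponent `A + 1`
  obtain ⟨C, hC⟩ := Literature.NumberTheory.LFunctions.siegel_walfisz_holds ((A : ℝ) + 1) (by positivity)
  set C₀ : ℝ := max C 0 with hC₀
  have hC₀0 : 0 ≤ C₀ := le_max_right _ _
  have hC' : ∀ x : ℝ, 2 ≤ x → ∀ q : ℕ, 1 ≤ q → (q : ℝ) ≤ Real.log x ^ ((A : ℝ) + 1) →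
      ∀ u : (ZMod q)ˣ, |chebyshevPsiMod q (u : ZMod q) x - x / Nat.totient q| ≤ C₀ * x / Real.log x ^ ((A : ℝ) + 1) := by
    intro x hx q hq hqx u
    have hx0 : 0 ≤ x := by linarith
    have hlog : 0 ≤ Real.log x ^ ((A : ℝ) + 1) := Real.rpow_nonneg (Real.log_nonneg (by linarith)) _
    calc |chebyshevPsiMod q (u : ZMod q) x - x / Nat.totient q| ≤ C * x / Real.log x ^ ((A : ℝ) + 1) :=
          hC x hx q hq hqx u
      _ ≤ C₀ * x / Real.log x ^ ((A : ℝ) + 1) :=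
          div_le_div_of_nonneg_right (mul_le_mul_of_nonneg_right (le_max_left _ _) hx0) hlog
  -- the slack parameter `δ`: `(1 + δ)² ≤ 1 + ε/2`
  set δ : ℝ := min 1 (ε / 6) with hδ
  have hδ0 : 0 < δ := lt_min one_pos (by positivity)
  have hδ1 : δ ≤ 1 := min_le_left _ _
  have hδε : δ ≤ ε / 6 := min_le_right _ _
  have hsq : (1 + δ) ^ 2 ≤ 1 + ε / 2 := by nlinarith
  -- eventual side conditions in `N`
  have hev₁ : ∀ᶠ N : ℕ in atTop, C₀ ≤ δ * Real.log N :=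
    (tendsto_natCast_atTop_atTop (R := ℝ)).eventually
      ((Real.tendsto_log_atTop.const_mul_atTop hδ0).eventually_ge_atTop C₀)
  have hev₂ : ∀ᶠ N : ℕ in atTop, Real.log N ^ (A + 2) ≤ (ε / 18) * N :=
    eventually_log_pow_le (A + 2) (by positivity)
  have hev₃ : ∀ᶠ N : ℕ in atTop, Real.log N ^ A ≤ (1 : ℝ) * N := eventually_log_pow_le A one_pos
  obtain ⟨N₀, hN₀⟩ := Filter.eventually_atTop.1 (hev₁.and (hev₂.and (hev₃.and (eventually_ge_atTop 3))))
  refine ⟨N₀, fun N hN q hq hqA => ?_⟩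
  obtain ⟨h₁, h₂, h₃, hN3⟩ := hN₀ N hN
  haveI : NeZero q := ⟨by omega⟩
  -- basic facts about `N`, `log N`, `q`, `φ(q)`
  have hN1 : 1 ≤ N := by omega
  have hNr : (3 : ℝ) ≤ N := by exact_mod_cast hN3
  have hNpos : (0 : ℝ) < N := by linarith
  have hlog1 : 1 ≤ Real.log N := by
    rw [Real.le_log_iff_exp_le (by linarith)]
    exact (Real.exp_one_lt_d9.le.trans (by norm_num)).trans hNr
  have hlog0 : 0 < Real.log N := by linarith
  have hqr : (1 : ℝ) ≤ q := by exact_mod_cast hq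
  have hφpos : (0 : ℝ) < Nat.totient q := by exact_mod_cast Nat.totient_pos.2 (by omega)
  have hφq : (Nat.totient q : ℝ) ≤ q := by exact_mod_cast Nat.totient_le q
  have hφA : (Nat.totient q : ℝ) ≤ Real.log N ^ A := hφq.trans hqA
  have hqN : q ≤ N := by
    have : (q : ℝ) ≤ N := hqA.trans (by simpa using h₃)
    exact_mod_cast this
  -- the level in Siegel–Walfisz form: `q ≤ (log N)^A ≤ (log N)^(A+1)` (real exponent)
  have hpow_succ : Real.log N ^ ((A : ℝ) + 1) = Real.log N ^ A * Real.log N := by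
    rw [Real.rpow_add hlog0, Real.rpow_natCast, Real.rpow_one]
  have hqA1 : (q : ℝ) ≤ Real.log N ^ ((A : ℝ) + 1) := by
    rw [hpow_succ]
    calc (q : ℝ) ≤ Real.log N ^ A := hqA
      _ = Real.log N ^ A * 1 := (mul_one _).symm
      _ ≤ Real.log N ^ A * Real.log N := mul_le_mul_of_nonneg_left hlog1 (pow_nonneg hlog0.le _)
  -- coprime classes: pointwise Siegel–Walfisz bound `ψ(N;q,a) ≤ (N/φ(q)) (1 + δ)`
  set M : ℝ := (N : ℝ) / Nat.totient q * (1 + δ) with hM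
  have hMa : ∀ a ∈ (range q).filter (fun a => a.Coprime q), classPsi N q a ≤ M := by
    intro a ha
    rw [mem_filter, mem_range] at ha
    have hsw := classPsi_sub_le_of_sw hC' (by omega) hq hqA1 ha.1 ha.2
    have hup : classPsi N q a ≤ N / Nat.totient q + C₀ * N / Real.log N ^ ((A : ℝ) + 1) := by
      linarith [(abs_le.1 hsw).2]
    -- `C₀ N/(log N)^(A+1) ≤ δ N/φ(q)` since `φ(q) ≤ (log N)^A` and `C₀ ≤ δ log N`
    have herr : C₀ * N / Real.log N ^ ((A : ℝ) + 1) ≤ δ * (N / Nat.totient q) := by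
      rw [hpow_succ, div_le_iff₀ (mul_pos (pow_pos hlog0 _) hlog0)]
      calc C₀ * N ≤ δ * Real.log N * N := mul_le_mul_of_nonneg_right h₁ hNpos.le
        _ = δ * (N / Nat.totient q) * (Nat.totient q * Real.log N) := by
            field_simp
        _ ≤ δ * (N / Nat.totient q) * (Real.log N ^ A * Real.log N) := by
            refine mul_le_mul_of_nonneg_left (mul_le_mul_of_nonneg_right hφA hlog0.le) ?_
            exact mul_nonneg hδ0.le (div_nonneg hNpos.le hφpos.le)
    calc classPsi N q a ≤ N / Nat.totient q + C₀ * N / Real.log N ^ ((A : ℝ) + 1) := hup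
      _ ≤ N / Nat.totient q + δ * (N / Nat.totient q) := by linarith
      _ = M := by rw [hM]; ring
  have hcop : ∑ a ∈ (range q).filter (fun a => a.Coprime q), classPsi N q a ^ 2 ≤
      (1 + ε / 2) * ((N : ℝ) ^ 2 / Nat.totient q) := by
    calc ∑ a ∈ (range q).filter (fun a => a.Coprime q), classPsi N q a ^ 2 ≤ (Nat.totient q : ℝ) * M ^ 2 :=
          sum_coprime_sq_le hMa
      _ = (1 + δ) ^ 2 * ((N : ℝ) ^ 2 / Nat.totient q) := by
          rw [hM]
          field_simp
      _ ≤ (1 + ε / 2) * ((N : ℝ) ^ 2 / Nat.totient q) :=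
          mul_le_mul_of_nonneg_right hsq (div_nonneg (sq_nonneg _) hφpos.le)
  -- non-coprime classes: `≤ 9 N log² N ≤ (ε/2) N²/φ(q)`
  have hnc : ∑ a ∈ (range q).filter (fun a => ¬ a.Coprime q), classPsi N q a ^ 2 ≤
      (ε / 2) * ((N : ℝ) ^ 2 / Nat.totient q) := by
    have h9 := GRHCalibration.sum_not_coprime_sq_le (q := q) hN1 hqN
    have hkey : 9 * (N : ℝ) * Real.log N ^ 2 * Nat.totient q ≤ (ε / 2) * (N : ℝ) ^ 2 := by
      have hφlog : (Nat.totient q : ℝ) * Real.log N ^ 2 ≤ Real.log N ^ (A + 2) := by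
        rw [pow_add]
        exact mul_le_mul_of_nonneg_right hφA (sq_nonneg _)
      calc 9 * (N : ℝ) * Real.log N ^ 2 * Nat.totient q = 9 * N * (Nat.totient q * Real.log N ^ 2) := by ring
        _ ≤ 9 * N * Real.log N ^ (A + 2) := mul_le_mul_of_nonneg_left hφlog (by positivity)
        _ ≤ 9 * N * ((ε / 18) * N) := mul_le_mul_of_nonneg_left h₂ (by positivity)
        _ = (ε / 2) * (N : ℝ) ^ 2 := by ring
    rw [← mul_div_assoc, le_div_iff₀ hφpos]
    calc (∑ a ∈ (range q).filter (fun a => ¬ a.Coprime q), classPsi N q a ^ 2) * Nat.totient q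
        ≤ 9 * N * Real.log N ^ 2 * Nat.totient q := mul_le_mul_of_nonneg_right h9 hφpos.le
      _ ≤ (ε / 2) * (N : ℝ) ^ 2 := hkey
  -- assemble
  have hsplit := sum_filter_add_sum_filter_not (range q) (fun a => a.Coprime q) (fun a => classPsi N q a ^ 2)
  have hNlog : 0 ≤ (N : ℝ) * Real.log N := mul_nonneg hNpos.le hlog0.le
  calc ∑ a ∈ range q, classPsi N q a ^ 2
      = ∑ a ∈ (range q).filter (fun a => a.Coprime q), classPsi N q a ^ 2 +
          ∑ a ∈ (range q).filter (fun a => ¬ a.Coprime q), classPsi N q a ^ 2 := hsplit.symm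
    _ ≤ (1 + ε / 2) * ((N : ℝ) ^ 2 / Nat.totient q) + (ε / 2) * ((N : ℝ) ^ 2 / Nat.totient q) :=
        add_le_add hcop hnc
    _ = (1 + ε) * ((N : ℝ) ^ 2 / Nat.totient q) := by ring
    _ ≤ (1 + ε) * ((N : ℝ) ^ 2 / Nat.totient q + N * Real.log N) := by
        refine mul_le_mul_of_nonneg_left ?_ (by linarith)
        linarith

/-! ### Beyond every power of `log N`: Page's theorem with the exceptional conductor removed -/

namespace SWCalibration

/-- From `log q ≤ (log N)^b` and `(log N)^b ≤ (1/2) log N`: `q ≤ N^{1/2}` (for `1 ≤ q`, `0 < N`). -/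
theorem le_sqrt_of_log_le {q : ℕ} {N b : ℝ} (hq : 1 ≤ q) (hN : 0 < N)
    (hqb : Real.log q ≤ Real.log N ^ b) (hb : Real.log N ^ b ≤ 1 / 2 * Real.log N) :
    (q : ℝ) ≤ N ^ (1 / 2 : ℝ) := by
  have hq0 : (0 : ℝ) < q := by exact_mod_cast hq
  rw [← Real.exp_log hq0, Real.rpow_def_of_pos hN, Real.exp_le_exp]
  linarith

/-- `(log N)^b ≤ (1/2) log N` eventually, for `b < 1`. -/
theorem eventually_log_rpow_le_half_log {b : ℝ} (hb : b < 1) :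
    ∀ᶠ N : ℕ in atTop, Real.log N ^ b ≤ 1 / 2 * Real.log N := by
  have h1b : 0 < 1 - b := by linarith
  have hev : ∀ᶠ N : ℕ in atTop, (2 : ℝ) ^ (1 / (1 - b)) ≤ Real.log N :=
    (tendsto_natCast_atTop_atTop (R := ℝ)).eventually
      (Real.tendsto_log_atTop.eventually_ge_atTop _)
  filter_upwards [hev] with N hN
  have h2 : (0 : ℝ) < (2 : ℝ) ^ (1 / (1 - b)) := by positivity
  have hL : 0 < Real.log N := h2.trans_le hN
  -- `2 ≤ (log N)^(1-b)`
  have hpow : (2 : ℝ) ≤ Real.log N ^ (1 - b) := by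
    calc (2 : ℝ) = ((2 : ℝ) ^ (1 / (1 - b))) ^ (1 - b) := by
          rw [← Real.rpow_mul (by norm_num), one_div_mul_cancel h1b.ne', Real.rpow_one]
      _ ≤ Real.log N ^ (1 - b) := Real.rpow_le_rpow h2.le hN h1b.le
  have hsplit : Real.log N = Real.log N ^ b * Real.log N ^ (1 - b) := by
    rw [← Real.rpow_add hL]
    norm_num
  have hb0 : 0 ≤ Real.log N ^ b := Real.rpow_nonneg hL.le _
  calc Real.log N ^ b = 1 / 2 * (Real.log N ^ b * 2) := by ring
    _ ≤ 1 / 2 * (Real.log N ^ b * Real.log N ^ (1 - b)) := by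
        exact mul_le_mul_of_nonneg_left (mul_le_mul_of_nonneg_left hpow hb0) (by norm_num)
    _ = 1 / 2 * Real.log N := by rw [← hsplit]

end SWCalibration

/-- **The `L`-atom up to level `exp((log N)^b)`, `b < 1/4`, OFF THE MULTIPLES OF ONE EXCEPTIONAL CONDUCTOR,
UNCONDITIONALLY** (seat c3; registered hook `lowClassSecondMoment_pageLevel` on stmt-Parity-14113): for
`0 < b < 1/4`, `A > 0` and `ε > 0`, for all large `N` there is `d : ℕ` — either `d = 0` (no exception) or
`d ≥ (log N)^A` (Siegel) — such that for every modulus `1 ≤ q` with `log q ≤ (log N)^b` and `d ∤ q`,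
`Σ_{a < q} ψ(N; q, a)² ≤ (1 + ε) (N²/φ(q) + N log N)`.
This is the conclusion of `LowClassSecondMoment` far beyond every power of `log N` (though still below every power
`N^{θ₁}`), for all moduli except the multiples of a single exceptional conductor per scale: the unconditional
frontier of the `L`-atom is exactly ONE possible exceptional (Landau–Page–Siegel) character. From the tree's PROVED
`Literature.NumberTheory.LFunctions.PageUniformPNT.chebyshevPsiMod_uniform_conductor` (Page's theorem, conductor
form, with Siegel's lower bound for the conductor) on the coprime classes and seat c2's `9 N log² N` on the others.
[cite: MontgomeryVaughan2007, Corollary 11.17] [cite: FordMaynardTao2018, Lemma 2.1] -/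
theorem lowClassSecondMoment_pageLevel :
    ∀ (b : ℝ), 0 < b → b < 1 / 4 → ∀ (A : ℝ), 0 < A → ∀ (ε : ℝ), 0 < ε → ∃ N₀ : ℕ, ∀ N : ℕ, N₀ ≤ N →
      ∃ d : ℕ, (d = 0 ∨ Real.log N ^ A ≤ (d : ℝ)) ∧
        ∀ q : ℕ, 1 ≤ q → Real.log q ≤ Real.log N ^ b → ¬ d ∣ q →
          ∑ a ∈ Finset.range q,
              Summit.Parity.GeneralizedHardyLittlewood.Cruxes.RelativeDimOne.GallagherBackwards.classPsi N q a ^ 2 ≤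
            (1 + ε) * ((N : ℝ) ^ 2 / Nat.totient q + N * Real.log N) := by
  intro b hb0 hb A hA ε hε
  -- the slack parameter `δ`: `(1 + δ)² ≤ 1 + ε/2`
  set δ : ℝ := min 1 (ε / 6) with hδ
  have hδ0 : 0 < δ := lt_min one_pos (by positivity)
  have hδ1 : δ ≤ 1 := min_le_left _ _
  have hδε : δ ≤ ε / 6 := min_le_right _ _
  have hsq : (1 + δ) ^ 2 ≤ 1 + ε / 2 := by nlinarith
  -- Page's theorem, conductor form, relative accuracy `δ`
  obtain ⟨X₀, hX₀⟩ :=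
    Literature.NumberTheory.LFunctions.PageUniformPNT.chebyshevPsiMod_uniform_conductor hb0 hb hδ0 hA
  -- eventual side conditions in `N`
  have hev₁ : ∀ᶠ N : ℕ in atTop, X₀ ≤ (N : ℝ) :=
    (tendsto_natCast_atTop_atTop (R := ℝ)).eventually (eventually_ge_atTop X₀)
  have hev₂ : ∀ᶠ N : ℕ in atTop, (1 : ℝ) * (N : ℝ) ^ (1 / 2 : ℝ) * Real.log N ^ 2 ≤ (ε / 18) * N :=
    GRHCalibration.eventually_rpow_mul_log_pow_le (θ₁ := 1 / 2) (by norm_num) 2 zero_le_one (by positivity)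
  have hev₃ : ∀ᶠ N : ℕ in atTop, Real.log N ^ b ≤ 1 / 2 * Real.log N :=
    eventually_log_rpow_le_half_log (by linarith)
  obtain ⟨N₀, hN₀⟩ := Filter.eventually_atTop.1 (hev₁.and (hev₂.and (hev₃.and (eventually_ge_atTop 3))))
  refine ⟨N₀, fun N hN => ?_⟩
  obtain ⟨h₁, h₂, h₃, hN3⟩ := hN₀ N hN
  obtain ⟨d, hd, hPage⟩ := hX₀ N h₁
  refine ⟨d, hd, fun q hq hqb hdq => ?_⟩
  haveI : NeZero q := ⟨by omega⟩
  -- basic facts about `N`, `log N`, `q`, `φ(q)`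
  have hN1 : 1 ≤ N := by omega
  have hNr : (3 : ℝ) ≤ N := by exact_mod_cast hN3
  have hNpos : (0 : ℝ) < N := by linarith
  have hlog0 : 0 < Real.log N := Real.log_pos (by linarith)
  have hφpos : (0 : ℝ) < Nat.totient q := by exact_mod_cast Nat.totient_pos.2 (by omega)
  have hφq : (Nat.totient q : ℝ) ≤ q := by exact_mod_cast Nat.totient_le q
  have hqsqrt : (q : ℝ) ≤ (N : ℝ) ^ (1 / 2 : ℝ) := le_sqrt_of_log_le hq hNpos hqb h₃
  have hsqrtN : (N : ℝ) ^ (1 / 2 : ℝ) ≤ N := by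
    calc (N : ℝ) ^ (1 / 2 : ℝ) ≤ (N : ℝ) ^ (1 : ℝ) :=
          Real.rpow_le_rpow_of_exponent_le (by linarith) (by norm_num)
      _ = N := Real.rpow_one _
  have hqN : q ≤ N := by exact_mod_cast hqsqrt.trans hsqrtN
  -- coprime classes: `ψ(N;q,a) ≤ (N/φ(q)) (1 + δ)`
  set M : ℝ := (N : ℝ) / Nat.totient q * (1 + δ) with hM
  have hMa : ∀ a ∈ (range q).filter (fun a => a.Coprime q), classPsi N q a ≤ M := by
    intro a ha
    rw [mem_filter, mem_range] at ha
    have h := hPage q hq hqb hdq (ZMod.unitOfCoprime a ha.2) N le_rfl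
    rw [ZMod.coe_unitOfCoprime, ← classPsi_eq_chebyshevPsiMod N ha.1] at h
    have hup : classPsi N q a ≤ N / Nat.totient q + δ * (N / Nat.totient q) := by
      linarith [(abs_le.1 h).2]
    calc classPsi N q a ≤ N / Nat.totient q + δ * (N / Nat.totient q) := hup
      _ = M := by rw [hM]; ring
  have hcop : ∑ a ∈ (range q).filter (fun a => a.Coprime q), classPsi N q a ^ 2 ≤
      (1 + ε / 2) * ((N : ℝ) ^ 2 / Nat.totient q) := by
    calc ∑ a ∈ (range q).filter (fun a => a.Coprime q), classPsi N q a ^ 2 ≤ (Nat.totient q : ℝ) * M ^ 2 :=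
          sum_coprime_sq_le hMa
      _ = (1 + δ) ^ 2 * ((N : ℝ) ^ 2 / Nat.totient q) := by
          rw [hM]
          field_simp
      _ ≤ (1 + ε / 2) * ((N : ℝ) ^ 2 / Nat.totient q) :=
          mul_le_mul_of_nonneg_right hsq (div_nonneg (sq_nonneg _) hφpos.le)
  -- non-coprime classes: `≤ 9 N log² N ≤ (ε/2) N²/φ(q)` since `φ(q) ≤ q ≤ N^{1/2}`
  have hnc : ∑ a ∈ (range q).filter (fun a => ¬ a.Coprime q), classPsi N q a ^ 2 ≤
      (ε / 2) * ((N : ℝ) ^ 2 / Nat.totient q) := by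
    have h9 := GRHCalibration.sum_not_coprime_sq_le (q := q) hN1 hqN
    have hkey : 9 * (N : ℝ) * Real.log N ^ 2 * Nat.totient q ≤ (ε / 2) * (N : ℝ) ^ 2 := by
      have hφs : (Nat.totient q : ℝ) ≤ (N : ℝ) ^ (1 / 2 : ℝ) := hφq.trans hqsqrt
      calc 9 * (N : ℝ) * Real.log N ^ 2 * Nat.totient q
          ≤ 9 * (N : ℝ) * Real.log N ^ 2 * (N : ℝ) ^ (1 / 2 : ℝ) :=
            mul_le_mul_of_nonneg_left hφs (by positivity)
        _ = 9 * N * ((1 : ℝ) * (N : ℝ) ^ (1 / 2 : ℝ) * Real.log N ^ 2) := by ring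
        _ ≤ 9 * N * ((ε / 18) * N) := mul_le_mul_of_nonneg_left h₂ (by positivity)
        _ = (ε / 2) * (N : ℝ) ^ 2 := by ring
    rw [← mul_div_assoc, le_div_iff₀ hφpos]
    calc (∑ a ∈ (range q).filter (fun a => ¬ a.Coprime q), classPsi N q a ^ 2) * Nat.totient q
        ≤ 9 * N * Real.log N ^ 2 * Nat.totient q := mul_le_mul_of_nonneg_right h9 hφpos.le
      _ ≤ (ε / 2) * (N : ℝ) ^ 2 := hkey
  -- assemble
  have hsplit := sum_filter_add_sum_filter_not (range q) (fun a => a.Coprime q) (fun a => classPsi N q a ^ 2)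
  have hNlog : 0 ≤ (N : ℝ) * Real.log N := mul_nonneg hNpos.le hlog0.le
  calc ∑ a ∈ range q, classPsi N q a ^ 2
      = ∑ a ∈ (range q).filter (fun a => a.Coprime q), classPsi N q a ^ 2 +
          ∑ a ∈ (range q).filter (fun a => ¬ a.Coprime q), classPsi N q a ^ 2 := hsplit.symm
    _ ≤ (1 + ε / 2) * ((N : ℝ) ^ 2 / Nat.totient q) + (ε / 2) * ((N : ℝ) ^ 2 / Nat.totient q) :=
        add_le_add hcop hnc
    _ = (1 + ε) * ((N : ℝ) ^ 2 / Nat.totient q) := by ring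
    _ ≤ (1 + ε) * ((N : ℝ) ^ 2 / Nat.totient q + N * Real.log N) := by
        refine mul_le_mul_of_nonneg_left ?_ (by linarith)
        linarith

end Summit.Parity.GeneralizedHardyLittlewood.Cruxes.RelativeDimOne.TypeSplit

end
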